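import Literature.MathematicalPhysics.QuantumFieldTheory.Balaban1983to89.B8Eq119TwistedAxial
import Literature.MathematicalPhysics.QuantumFieldTheory.Balaban1983to89.B7AvgGaugeCovariance
import Literature.MathematicalPhysics.QuantumFieldTheory.Balaban1983to89.B8ConstraintBonds

/-!
# `Balaban1983to89.B8Eq113ClassBk` — T. Bałaban, *Spaces of regular gauge field configurations on a lattice and gauge
# fixing conditions*, Commun. Math. Phys. **99** (1985) 75–102 [Balaban1985RegularSpaces] ("B8"), **(1.12)–(1.13)** p. 78
# and **(1.28)** p. 81: THE CLASS `𝔅_k(𝔅_k, V)` («Ūʲ = V on Λ_j») WITH PRINT'S AVERAGES `Ūʲ` ON THE B7 `ℤ^d` CARRIER, and the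
# class (1.28) `𝔄_k({Ω_j}, α₀) ∩ 𝔅_k(𝔅_k, V) ∩ Ax_k(𝔅_k, U₀)` as ONE typed conjunction

statement-level skeleton of published theorems with citation tags; proofs where landed; nothing here is a claim about the
Yang–Mills mass gap

PDF held: `paper:balaban1985-cmp99-regular-spaces-gauge-fixing` (journal page = PDF page + 74); pp. 77, 78, 81 [PDF 3, 4, 7]
read this session AS IMAGES on the ×2 renders `run/shared/lean/pub/pub-balaban/b2b-balaban-ref1/pages/1985-cmp99-regular-
spaces-gauge-fixing/…-p003-x2.png`, `…-p004-x2.png`, `…-p007-x2.png`.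

CITATION HEADER (lean-in-tree rule).  Part of the lit-balaban TYPED SKELETON (HOME `run/shared/lean/pub/lit-balaban/`), unit
`lit-balaban-r13` gen 99 (free-target protocol G.5-34(d), on the written welcome of the row owner r05 g69, 2026-08-23).
Serves rows `B8.Eq1.13` ((1.12)–(1.13)) and `B8.Eq1.28` ((1.28)) of `HOME/lit-balaban-r05/ROWS-B8.md`: it is the OWED MEMBER
named by the owner's audit `HOME/lit-balaban-r05/READING-RULE-AUDIT-B8-g69.md` §3.2/§3.3 («print's instance (avg = the iterated
averages Ūʲ = `B7Prop2Explicit.avgIter`, bonds = level-j bonds "on Λ_j" in the p.77 convention) is not IDENTIFIED with `Constr`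
by a kernel theorem, and no named predicate "U ∈ 𝔅_k(𝔅_k, V)" exists on the carrier where print consumes (1.13) ((1.28), (1.30));
hence (1.28) is not one typed conjunction either. OWED MEMBER …: `InBk` … (literal reading; the G-adv8-10 repair R_B as a named
variant), the covariance sentence p.78 l.5 from `B7AvgGaugeCovariance.avgIter_gaugeAct`, and `Class128 := InAk ∧ InBk ∧ InAx`
for (1.28)»).  Nothing landed is edited or restated: `B7Prop2Explicit.avgIter` ((43), the `j`-fold average `Ūʲ`),
`B7Prop1Explicit.gaugeAct` ((8)), `B7AvgGaugeCovariance.avgIter_gaugeAct` ((11) iterated, pub-balaban cell),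
`B8Ineq132.InAk` (`𝔄_k`, (1.7)/(1.9)), `B8Eq119TwistedAxial.InAx` (`Ax_k`, (1.19)), and the fine-coordinate records of
`B8ConstraintBonds` (`Lam` (1.5), `Bk` (1.12), `literalBonds`/`bondsB`, `Constr` (1.13) over an ABSTRACT averaging, `ResGauge`
(1.14)) are imported and used BY NAME.

THE PRINTED TEXT.  p. 77 [PDF 3] (the bond convention), verbatim: *"The sets Ω_j are identified with sets of bonds, or sets of
plaquettes, in the following way. If Ω ⊂ T_η, then we denote by Ω also the set of bonds ⋃_{x∈Ω} st(x) = {bonds b ⊂ T_η: at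
least one end-point of b belongs to Ω}. … This convention applies to an arbitrary lattice."*  p. 78 [PDF 4], verbatim: *"Let
us introduce further notations and definitions. We denote 𝔅_k = ⋃_{j=0}^{k} Λ_j (1.12) (the same for the sets of bonds), and
for an arbitrary configuration V on 𝔅_k we define 𝔅_k(𝔅_k, V) is a set of all gauge field configurations U satisfying the
conditions Ūʲ = V on Λ_j, j = 0, …, k. (1.13) Because (Ū^{u j})_b = (Ūʲ)^u_b = u(b₋)(Ūʲ)_b u⁻¹(b₊) for b ⊂ T^{(j)}, hence
the set 𝔅_k(𝔅_k, V) is invariant with respect to gauge transformations u satisfying the conditions u(y) = 1 for y ∈ 𝔅_k.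
(1.14)"*  p. 81 [PDF 7], verbatim: *"As the preliminary gauge condition we choose the axial gauge given by the Eq. (1.19).
Now we can formulate the problem precisely. Let us take an arbitrary U′ such that U′U₀ ∈ 𝔄_k({Ω_j}, α₀) ∩ 𝔅_k(𝔅_k, V) ∩
Ax_k(𝔅_k, U₀) (1.28)"*.

WHAT IS TYPED AND PROVED (definitions WITH BODY + theorems; no `Prop`-valued fact).
* §1 **`InBkOn` / `InBk`** — (1.13) «Ūʲ = V on Λ_j, j = 0, …, k» WITH PRINT'S AVERAGES: `Ūʲ = B7Prop2Explicit.avgIter L U j`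
  on the B7 `ℤ^d` carrier (level `j` rescaled to `ℤ^d`: the level-`j` bond `⟨Lʲy, Lʲy + Lʲe_κ⟩` is `(y, κ)`), the constraint
  imposed on a bond family `bonds j` (`InBkOn`, generic — the object under adjudication in GAPS G-adv8-10) and, for `InBk`, on
  print's LITERAL family `bondsOn Λ j` = the level-`j` bonds with at least one end-point in `Λ_j` (p. 77 convention; `Λ_j` in
  level-`j` coordinates, the argument shape of `B8Eq119TwistedAxial.InAx`); `V : ℕ → (ℤ^d → Fin d → 𝔸ˣ)` = the prescribed
  configuration on the bonds of `𝔅_k`, level by level.  `inBkOn_mono`, `inBk_self` (non-vacuity: `U ∈ 𝔅_k(𝔅_k, Ū)`).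
* §2 **THE IDENTIFICATION WITH `B8ConstraintBonds`** (fine coordinates): `levelSet L Ω j` = `Λ_j` of (1.5)
  (`B8ConstraintBonds.Lam L Ω j`, fine coordinates) read in level-`j` coordinates; `smul_pow_eq_src` / `smul_pow_add_e_eq_tgt`
  (the end-points `Lʲy`, `Lʲ(y + e_κ)` ARE `B8ConstraintBonds.src/tgt L j (y, κ)`); **`mem_bondsOn_levelSet_iff`**:
  `(y, κ) ∈ bondsOn (levelSet L Ω) j ↔ (y, κ) ∈ B8ConstraintBonds.literalBonds L Ω j`; **`inBk_iff_mem_constr`**: `InBk` IS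
  membership of the uncurried configuration in `B8ConstraintBonds.Constr (literal bonds, truncated at k) avg V` AT THE INSTANCE
  `avg j := Ūʲ` (`avgLG`) — the abstract averaging of that record instantiated with print's averages.
* §3 **p. 78 l. 5, the covariance sentence FOR PRINT'S AVERAGES**: `avgIter_gaugeAct_bond` — in the regime of [3] Prop. 2 where
  the nonlinear averages are covariant (`B7AvgGaugeCovariance.avgIter_gaugeAct`: `L ≥ 2`, a closed gauge group `G`, `G`-valued
  `U`, `U(1)`-bounded `u`, (52) `pdev U < α₀L^{−2k}` with `C₀α₀ ≤ 1/3`, `2α₀ ≤ c₂′`), for every level-`j` bond `b = (y, κ)`,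
  `j ≤ k`: `(Ū^{u j})_b = u(b₋)(Ūʲ)_b u(b₊)⁻¹` with `b₋ = Lʲy`, `b₊ = Lʲ(y + e_κ)` — `avgIter_gaugeAct_bond_srcTgt` writes it
  with `B8ConstraintBonds.src/tgt`, i.e. EXACTLY the shape `B8ConstraintBonds.CovLaw` postulates for an abstract averaging
  (here a theorem in the Prop-2 regime, not for all `U`); and the invariance half of the sentence in the form that holds:
  **`inBkOn_gaugeAct_of_endpoints`** — if `u = 1` at BOTH end-points of every constraint bond (e.g. `u ∈ ResGauge B` with all
  end-points in `B`: `inBkOn_gaugeAct_of_resGauge`), then `U ∈ 𝔅_k(bonds, V) ⇒ U^u ∈ 𝔅_k(bonds, V)` in that regime (the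
  literal family does NOT have this property in general — `B8ConstraintBonds.literal_not_Invariant`, GAPS G-adv8-10, row
  B8.Eq1.14; the repair R_B `bondsB` has all end-points in `𝔅_k` by definition).
* §4 **`Class128`** — (1.28) «U′U₀ ∈ 𝔄_k({Ω_j}, α₀) ∩ 𝔅_k(𝔅_k, V) ∩ Ax_k(𝔅_k, U₀)» as ONE conjunction on the carrier of
  record: `B8Ineq132.InAk L k η α₀ Ω (U′·U₀) ∧ InBk L k Λ V (U′·U₀) ∧ B8Eq119TwistedAxial.InAx L k Λ U₀ (U′·U₀)` ((1.16)
  `U = U′U₀` bondwise; `Ω` = the domains `{Ω_j}` in fine coordinates as `InAk` takes them, `Λ` = the sets `Λ_j` in level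
  coordinates as `InAx` takes them — for the Sect. F family `B8Eq131Cubes.cube` / `LamP`, exactly the binders of
  `B8Eq119TwistedAxial.Thm4At`), with the projections `Class128.inAk/inBk/inAx` and `class128_iff`.
HONEST SCOPE.  (i) Carrier: the B7/B8 `ℤ^d` carrier (`ℤ^d → Fin d → 𝔸ˣ`, `η = 1`, every level rescaled to `ℤ^d`), print's
`T_η` being a torus.  (ii) (1.13) is typed for print's averages `Ūʲ = avgIter` ((43) of [3], the tree's reading of the `j`-fold
average); the constraint-bond family is a PARAMETER (`InBkOn`) because its literal p. 77 reading makes p. 78's invariance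
sentence false (`B8ConstraintBonds.literal_not_Invariant`, G-adv8-10, adjudicated there, not here): `InBk` = the literal
reading, `InBkOn L k (… bondsB …)`-type families = the repairs; nothing is asserted about which family the later papers use.
(iii) The covariance law of p. 78 l. 5 is a theorem for print's (nonlinear) averages only in the regime of [3] Prop. 2 (where
the logarithms in (42)–(43) are defined) — `B7AvgGaugeCovariance` — and is stated here with exactly those hypotheses; the
unconditional `B8ConstraintBonds.CovLaw` is not claimed for `avgIter`.  (iv) (1.12) `𝔅_k` as a point set is
`B8ConstraintBonds.Bk` (fine coordinates) and is not re-typed.  Nothing here is new mathematics; imports Literature only;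
standard axioms.
-/

noncomputable section

namespace Literature.MathematicalPhysics.QuantumFieldTheory.Balaban1983to89.B8Eq113ClassBk

open Literature.MathematicalPhysics.QuantumLattice (ZdEdge LGConfig gaugeTransformZd blockBase)
open B7Prop1Explicit (e e_apply gaugeAct U1)
open B7Prop2Explicit (avgIter pdev C0 c2' AvgClosed)
open B7AvgGaugeCovariance (uLev uLev_apply avgIter_gaugeAct)
open B8Ineq132 (InAk)
open B8Eq119TwistedAxial (InAx)
open B8ConstraintBonds (Lam Bk literalBonds bondsB Constr ResGauge step step_apply_same step_apply_ne)

-- `Site` alone would resolve to the torus sites of `Setup.lean`; re-export the `ℤ^d` sites of `B7Prop1Explicit`.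
export B7Prop1Explicit (Site)

variable {d : ℕ}

/-! ## §1 (1.13) with print's averages, on a bond family; the literal family «on Λ_j» -/

/-- The p. 77 bond convention at level `j` (level-`j` lattice rescaled to `ℤ^d`): *"we denote by Ω also the set of bonds …
at least one end-point of b belongs to Ω … This convention applies to an arbitrary lattice"* — the level-`j` bonds
`b = (y, κ) = ⟨y, y + e_κ⟩` with `y ∈ Λ_j` or `y + e_κ ∈ Λ_j`, `Λ_j` given in level-`j` coordinates.
[cite: Balaban1985RegularSpaces, p.77 (bond convention), (1.13) p.78] -/
def bondsOn (Λ : ℕ → Set (Site d)) (j : ℕ) : Set (ZdEdge d) := {c | c.1 ∈ Λ j ∨ c.1 + e c.2 ∈ Λ j}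

/-- Membership in `bondsOn`, unfolded. [cite: Balaban1985RegularSpaces, p.77 (bond convention)] -/
theorem mem_bondsOn (Λ : ℕ → Set (Site d)) (j : ℕ) (y : Site d) (κ : Fin d) :
    (y, κ) ∈ bondsOn Λ j ↔ y ∈ Λ j ∨ y + e κ ∈ Λ j :=
  Iff.rfl

section Classes

variable {𝔸 : Type*} [NormedRing 𝔸] [NormOneClass 𝔸] [NormedAlgebra ℂ 𝔸] [CompleteSpace 𝔸]

omit [NormOneClass 𝔸] in
/-- **(1.13) on a constraint-bond family** p. 78, verbatim: *"𝔅_k(𝔅_k, V) is a set of all gauge field configurations U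
satisfying the conditions Ūʲ = V on Λ_j, j = 0, …, k. (1.13)"* — WITH PRINT'S AVERAGES `Ūʲ = B7Prop2Explicit.avgIter L U j`
((43) of [3]) on the B7 `ℤ^d` carrier, the constraint imposed on the level-`j` bonds of `bonds j` (labelled `(y, κ)` =
`⟨Lʲy, Lʲy + Lʲe_κ⟩`), `j ≤ k`; `V j` = the prescribed configuration on the level-`j` bonds of `𝔅_k`.  The family `bonds`
is a parameter: its literal reading is `bondsOn Λ` (`InBk`), the repairs of GAPS G-adv8-10 are other families.
[cite: Balaban1985RegularSpaces, (1.13) p.78] -/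
def InBkOn (L k : ℕ) (bonds : ℕ → Set (ZdEdge d)) (V : ℕ → Site d → Fin d → 𝔸ˣ) (U : Site d → Fin d → 𝔸ˣ) :
    Prop :=
  ∀ j, j ≤ k → ∀ (y : Site d) (κ : Fin d), (y, κ) ∈ bonds j → avgIter L U j y κ = V j y κ

omit [NormOneClass 𝔸] in
/-- **(1.13), `U ∈ 𝔅_k(𝔅_k, V)`, LITERAL READING** («Ūʲ = V on Λ_j» with the p. 77 bond convention: every level-`j` bond with
at least one end-point in `Λ_j`), `Λ_j` in level-`j` coordinates (the argument shape of `B8Eq119TwistedAxial.InAx`).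
[cite: Balaban1985RegularSpaces, (1.13) p.78, p.77 (bond convention)] -/
def InBk (L k : ℕ) (Λ : ℕ → Set (Site d)) (V : ℕ → Site d → Fin d → 𝔸ˣ) (U : Site d → Fin d → 𝔸ˣ) : Prop :=
  InBkOn L k (bondsOn Λ) V U

omit [NormOneClass 𝔸] in
/-- Unfolding of `InBk`. [cite: Balaban1985RegularSpaces, (1.13) p.78] -/
theorem inBk_iff (L k : ℕ) (Λ : ℕ → Set (Site d)) (V : ℕ → Site d → Fin d → 𝔸ˣ) (U : Site d → Fin d → 𝔸ˣ) :
    InBk L k Λ V U ↔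
      ∀ j, j ≤ k → ∀ (y : Site d) (κ : Fin d), (y ∈ Λ j ∨ y + e κ ∈ Λ j) → avgIter L U j y κ = V j y κ :=
  Iff.rfl

omit [NormOneClass 𝔸] in
/-- (1.13) is monotone in the constraint-bond family: fewer constraint bonds, larger class (so every repair family contained
in the literal one is implied by the literal reading). [cite: Balaban1985RegularSpaces, (1.13) p.78] -/
theorem inBkOn_mono {L k : ℕ} {bonds bonds' : ℕ → Set (ZdEdge d)} (h : ∀ j, bonds' j ⊆ bonds j)
    {V : ℕ → Site d → Fin d → 𝔸ˣ} {U : Site d → Fin d → 𝔸ˣ} (hU : InBkOn L k bonds V U) : InBkOn L k bonds' V U :=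
  fun j hj y κ hc => hU j hj y κ (h j hc)

omit [NormOneClass 𝔸] in
/-- Non-vacuity: `U ∈ 𝔅_k(𝔅_k, V)` for `V` = the averages of `U` itself. [cite: Balaban1985RegularSpaces, (1.13) p.78] -/
theorem inBk_self (L k : ℕ) (Λ : ℕ → Set (Site d)) (U : Site d → Fin d → 𝔸ˣ) :
    InBk L k Λ (fun j => avgIter L U j) U :=
  fun _ _ _ _ _ => rfl

end Classes

/-! ## §2 The identification with the fine-coordinate record `B8ConstraintBonds` -/

/-- `Λ_j` of (1.5) (`B8ConstraintBonds.Lam L Ω j`, a set of level-`j` points of the FINE lattice) read in level-`j`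
coordinates: `y ↦ Lʲy`. [cite: Balaban1985RegularSpaces, (1.5) p.77] -/
def levelSet (L : ℕ) (Ω : ℕ → Set (Site d)) (j : ℕ) : Set (Site d) := {y | ((L : ℤ) ^ j) • y ∈ Lam L Ω j}

/-- Membership in `levelSet`, unfolded. [cite: Balaban1985RegularSpaces, (1.5) p.77] -/
theorem mem_levelSet (L : ℕ) (Ω : ℕ → Set (Site d)) (j : ℕ) (y : Site d) :
    y ∈ levelSet L Ω j ↔ ((L : ℤ) ^ j) • y ∈ Lam L Ω j :=
  Iff.rfl

/-- The fine end-point `b₋ = Lʲy` of the level-`j` bond `(y, κ)` is `B8ConstraintBonds.src L j (y, κ)`.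
[cite: Balaban1985RegularSpaces, p.77 (bond convention)] -/
theorem smul_pow_eq_src (L j : ℕ) (y : Site d) (κ : Fin d) :
    ((L : ℤ) ^ j) • y = B8ConstraintBonds.src L j (y, κ) := by
  funext i
  simp [B8ConstraintBonds.src, blockBase, Pi.smul_apply]

/-- The fine end-point `b₊ = Lʲ(y + e_κ)` of the level-`j` bond `(y, κ)` is `B8ConstraintBonds.tgt L j (y, κ)`.
[cite: Balaban1985RegularSpaces, p.77 (bond convention)] -/
theorem smul_pow_add_e_eq_tgt (L j : ℕ) (y : Site d) (κ : Fin d) :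
    ((L : ℤ) ^ j) • (y + e κ) = B8ConstraintBonds.tgt L j (y, κ) := by
  funext i
  simp only [B8ConstraintBonds.tgt, blockBase, Pi.smul_apply, Pi.add_apply, smul_eq_mul, e_apply]
  by_cases hi : i = κ
  · subst hi
    rw [step_apply_same, if_pos rfl]
    push_cast
    ring
  · rw [step_apply_ne L j hi, if_neg hi]
    push_cast
    ring

/-- **The literal bond family IS `B8ConstraintBonds.literalBonds`**: with `Λ_j` = the (1.5) sets of the domain family `Ω` read
in level coordinates, «at least one end-point in Λ_j» in level coordinates is that record's literal reading in fine
coordinates. [cite: Balaban1985RegularSpaces, p.77 (bond convention), (1.13) p.78] -/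
theorem mem_bondsOn_levelSet_iff (L : ℕ) (Ω : ℕ → Set (Site d)) (j : ℕ) (y : Site d) (κ : Fin d) :
    (y, κ) ∈ bondsOn (levelSet L Ω) j ↔ (y, κ) ∈ literalBonds L Ω j := by
  simp only [mem_bondsOn, mem_levelSet, literalBonds, Set.mem_setOf_eq, smul_pow_eq_src L j y κ,
    smul_pow_add_e_eq_tgt L j y κ]

section Constr

variable {𝔸 : Type*} [NormedRing 𝔸] [NormedAlgebra ℂ 𝔸] [CompleteSpace 𝔸]

/-- Uncurrying the B7 carrier `ℤ^d → Fin d → G` to the prelude's `LGConfig d G = ZdEdge d → G`. [folklore] -/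
def toLG {G : Type*} (U : Site d → Fin d → G) : LGConfig d G := fun c => U c.1 c.2

/-- Currying back. [folklore] -/
def ofLG {G : Type*} (W : LGConfig d G) : Site d → Fin d → G := fun y κ => W (y, κ)

/-- Print's level-`j` averaging `Ūʲ` as an averaging family in the sense of `B8ConstraintBonds.Constr`/`CovLaw`
(`avg j : LGConfig → LGConfig`, values on level-`j` bonds labelled by coarse edges). [cite: Balaban1985RegularSpaces, (1.13) p.78] -/
def avgLG (L : ℕ) (j : ℕ) (W : LGConfig d 𝔸ˣ) : LGConfig d 𝔸ˣ := toLG (avgIter L (ofLG W) j)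

/-- The constraint-bond family truncated at `k` («j = 0, …, k»). [cite: Balaban1985RegularSpaces, (1.13) p.78] -/
def truncBonds (k : ℕ) (bonds : ℕ → Set (ZdEdge d)) (j : ℕ) : Set (ZdEdge d) := if j ≤ k then bonds j else ∅

/-- **`InBkOn` IS `B8ConstraintBonds.Constr` AT PRINT'S AVERAGES**: `U ∈ 𝔅_k(bonds, V)` iff the uncurried `U` lies in that
record's `Constr (truncBonds k bonds) (avgLG L) V` — the record's abstract averaging instantiated with `Ūʲ = avgIter`.
[cite: Balaban1985RegularSpaces, (1.13) p.78] -/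
theorem inBkOn_iff_mem_constr (L k : ℕ) (bonds : ℕ → Set (ZdEdge d)) (V : ℕ → Site d → Fin d → 𝔸ˣ)
    (U : Site d → Fin d → 𝔸ˣ) :
    InBkOn L k bonds V U ↔ toLG U ∈ Constr (truncBonds k bonds) (avgLG L) (fun j c => V j c.1 c.2) := by
  simp only [InBkOn, Constr, truncBonds, avgLG, toLG, Set.mem_setOf_eq]
  constructor
  · intro h j c hc
    by_cases hj : j ≤ k
    · rw [if_pos hj] at hc
      exact h j hj c.1 c.2 hc
    · rw [if_neg hj] at hc
      exact absurd hc (Set.notMem_empty _)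
  · intro h j hj y κ hc
    have := h j (y, κ) (by rw [if_pos hj]; exact hc)
    exact this

/-- **`InBk` for the (1.5)-sets of a domain family IS `Constr` on the LITERAL bonds of `B8ConstraintBonds`** at print's
averages. [cite: Balaban1985RegularSpaces, (1.13) p.78, p.77 (bond convention)] -/
theorem inBk_iff_mem_constr (L k : ℕ) (Ω : ℕ → Set (Site d)) (V : ℕ → Site d → Fin d → 𝔸ˣ)
    (U : Site d → Fin d → 𝔸ˣ) :
    InBk L k (levelSet L Ω) V U ↔
      toLG U ∈ Constr (truncBonds k (literalBonds L Ω)) (avgLG L) (fun j c => V j c.1 c.2) := by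
  rw [← inBkOn_iff_mem_constr]
  simp only [InBk, InBkOn]
  constructor
  · intro h j hj y κ hc
    exact h j hj y κ ((mem_bondsOn_levelSet_iff L Ω j y κ).mpr hc)
  · intro h j hj y κ hc
    exact h j hj y κ ((mem_bondsOn_levelSet_iff L Ω j y κ).mp hc)

/-- The B7 gauge action (8) uncurries to the prelude's `gaugeTransformZd`. [cite: Balaban1985Averaging, (8) p.18] -/
theorem toLG_gaugeAct {G : Type*} [Group G] (u : Site d → G) (U : Site d → Fin d → G) :
    toLG (gaugeAct u U) = gaugeTransformZd u (toLG U) := by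
  funext c
  simp [toLG, gaugeAct, gaugeTransformZd, e]

end Constr

/-! ## §3 p. 78 l. 5: the covariance sentence for print's averages, and the invariance it gives -/

section Covariance

variable {𝔸 : Type*} [NormedRing 𝔸] [NormOneClass 𝔸] [NormedAlgebra ℂ 𝔸] [CompleteSpace 𝔸]

/-- **p. 78 l. 5 FOR PRINT'S AVERAGES**, verbatim: *"(Ū^{u j})_b = (Ūʲ)^u_b = u(b₋)(Ūʲ)_b u⁻¹(b₊) for b ⊂ T^{(j)}"* — in the
regime of [3] Prop. 2 in which the nonlinear averages are gauge covariant (`B7AvgGaugeCovariance.avgIter_gaugeAct`), for every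
level-`j` bond `b = (y, κ)`, `j ≤ k`: `(Ū^{u j})_b = u(Lʲy)·(Ūʲ)_b·u(Lʲ(y + e_κ))⁻¹` (`b₋ = Lʲy`, `b₊ = Lʲ(y + e_κ)` in fine
coordinates). [cite: Balaban1985RegularSpaces, p.78 l.5; Balaban1985Averaging, (11) p.19, (43) p.24] -/
theorem avgIter_gaugeAct_bond (L : ℕ) (hL : 2 ≤ L) {G : Subgroup 𝔸ˣ} (hG : AvgClosed d L G) (k : ℕ)
    (U : Site d → Fin d → 𝔸ˣ) (hU : ∀ x κ, U x κ ∈ G) {u : Site d → 𝔸ˣ} (hu : ∀ x, u x ∈ U1 𝔸)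
    {α₀ : ℝ} (hα : 0 < α₀) (hα3 : C0 d * α₀ ≤ 1 / 3) (hα2 : 2 * α₀ ≤ c2' d L)
    (h52 : pdev U < α₀ * (((L : ℝ) ^ k)⁻¹) ^ 2) {j : ℕ} (hj : j ≤ k) (y : Site d) (κ : Fin d) :
    avgIter L (gaugeAct u U) j y κ
      = u (((L : ℤ) ^ j) • y) * avgIter L U j y κ * (u (((L : ℤ) ^ j) • (y + e κ)))⁻¹ := by
  rw [avgIter_gaugeAct L hL hG k U hU hu hα hα3 hα2 h52 j hj]
  simp only [gaugeAct, uLev_apply, smul_add]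

/-- The same covariance law written with `B8ConstraintBonds.src/tgt` — EXACTLY the shape that record's `CovLaw` postulates for
an abstract averaging, here a theorem for `Ūʲ = avgIter` in the Prop-2 regime. [cite: Balaban1985RegularSpaces, p.78 l.5] -/
theorem avgIter_gaugeAct_bond_srcTgt (L : ℕ) (hL : 2 ≤ L) {G : Subgroup 𝔸ˣ} (hG : AvgClosed d L G) (k : ℕ)
    (U : Site d → Fin d → 𝔸ˣ) (hU : ∀ x κ, U x κ ∈ G) {u : Site d → 𝔸ˣ} (hu : ∀ x, u x ∈ U1 𝔸)
    {α₀ : ℝ} (hα : 0 < α₀) (hα3 : C0 d * α₀ ≤ 1 / 3) (hα2 : 2 * α₀ ≤ c2' d L)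
    (h52 : pdev U < α₀ * (((L : ℝ) ^ k)⁻¹) ^ 2) {j : ℕ} (hj : j ≤ k) (y : Site d) (κ : Fin d) :
    avgIter L (gaugeAct u U) j y κ
      = u (B8ConstraintBonds.src L j (y, κ)) * avgIter L U j y κ * (u (B8ConstraintBonds.tgt L j (y, κ)))⁻¹ := by
  rw [avgIter_gaugeAct_bond L hL hG k U hU hu hα hα3 hα2 h52 hj, smul_pow_eq_src L j y κ, smul_pow_add_e_eq_tgt]

/-- **p. 78, the invariance half of the sentence, IN THE FORM THAT HOLDS** («hence the set 𝔅_k(𝔅_k, V) is invariant with respect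
to gauge transformations u satisfying … u(y) = 1 for y ∈ 𝔅_k (1.14)»): in the Prop-2 regime, if `u = 1` at BOTH fine
end-points `Lʲy`, `Lʲ(y + e_κ)` of every constraint bond, then `U ∈ 𝔅_k(bonds, V) ⇒ U^u ∈ 𝔅_k(bonds, V)`.  (For the
literal family this two-end-point condition fails on the inner boundary bonds — `B8ConstraintBonds.literal_not_Invariant`,
GAPS G-adv8-10; it holds by definition for the repair `B8ConstraintBonds.bondsB`.)
[cite: Balaban1985RegularSpaces, p.78 l.5–7, (1.14) p.78] -/
theorem inBkOn_gaugeAct_of_endpoints (L : ℕ) (hL : 2 ≤ L) {G : Subgroup 𝔸ˣ} (hG : AvgClosed d L G) (k : ℕ)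
    {bonds : ℕ → Set (ZdEdge d)} {V : ℕ → Site d → Fin d → 𝔸ˣ}
    (U : Site d → Fin d → 𝔸ˣ) (hU : ∀ x κ, U x κ ∈ G) {u : Site d → 𝔸ˣ} (hu : ∀ x, u x ∈ U1 𝔸)
    {α₀ : ℝ} (hα : 0 < α₀) (hα3 : C0 d * α₀ ≤ 1 / 3) (hα2 : 2 * α₀ ≤ c2' d L)
    (h52 : pdev U < α₀ * (((L : ℝ) ^ k)⁻¹) ^ 2)
    (hends : ∀ j, j ≤ k → ∀ (y : Site d) (κ : Fin d), (y, κ) ∈ bonds j →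
      u (((L : ℤ) ^ j) • y) = 1 ∧ u (((L : ℤ) ^ j) • (y + e κ)) = 1)
    (hB : InBkOn L k bonds V U) : InBkOn L k bonds V (gaugeAct u U) := by
  intro j hj y κ hc
  obtain ⟨h1, h2⟩ := hends j hj y κ hc
  rw [avgIter_gaugeAct_bond L hL hG k U hU hu hα hα3 hα2 h52 hj, h1, h2, inv_one, one_mul, mul_one]
  exact hB j hj y κ hc

/-- The invariance under the restricted gauge transformations (1.14) `u ∈ ResGauge B` (`u = 1` on `B`,
`B8ConstraintBonds.ResGauge`) for any constraint-bond family all of whose fine end-points lie in `B` (the repair-R_B situation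
of GAPS G-adv8-10: both end-points in `𝔅_k`), Prop-2 regime. [cite: Balaban1985RegularSpaces, (1.14) p.78, p.78 l.5–7] -/
theorem inBkOn_gaugeAct_of_resGauge (L : ℕ) (hL : 2 ≤ L) {G : Subgroup 𝔸ˣ} (hG : AvgClosed d L G) (k : ℕ)
    {bonds : ℕ → Set (ZdEdge d)} {B : Set (Site d)}
    (hbonds : ∀ j, j ≤ k → ∀ (y : Site d) (κ : Fin d), (y, κ) ∈ bonds j →
      ((L : ℤ) ^ j) • y ∈ B ∧ ((L : ℤ) ^ j) • (y + e κ) ∈ B)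
    {V : ℕ → Site d → Fin d → 𝔸ˣ} (U : Site d → Fin d → 𝔸ˣ) (hU : ∀ x κ, U x κ ∈ G)
    {u : Site d → 𝔸ˣ} (hu : ∀ x, u x ∈ U1 𝔸) (huB : u ∈ ResGauge B)
    {α₀ : ℝ} (hα : 0 < α₀) (hα3 : C0 d * α₀ ≤ 1 / 3) (hα2 : 2 * α₀ ≤ c2' d L)
    (h52 : pdev U < α₀ * (((L : ℝ) ^ k)⁻¹) ^ 2) (hB : InBkOn L k bonds V U) : InBkOn L k bonds V (gaugeAct u U) :=
  inBkOn_gaugeAct_of_endpoints L hL hG k U hU hu hα hα3 hα2 h52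
    (fun j hj y κ hc => ⟨huB _ (hbonds j hj y κ hc).1, huB _ (hbonds j hj y κ hc).2⟩) hB

end Covariance

/-! ## §4 (1.28): the class `𝔄_k({Ω_j}, α₀) ∩ 𝔅_k(𝔅_k, V) ∩ Ax_k(𝔅_k, U₀)` as one conjunction -/

section Class128

variable {𝔸 : Type*} [NormedRing 𝔸] [NormOneClass 𝔸] [NormedAlgebra ℂ 𝔸] [CompleteSpace 𝔸]

omit [NormOneClass 𝔸] in
/-- **(1.28)** p. 81, verbatim: *"Let us take an arbitrary U′ such that U′U₀ ∈ 𝔄_k({Ω_j}, α₀) ∩ 𝔅_k(𝔅_k, V) ∩ Ax_k(𝔅_k, U₀)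
(1.28)"* — ONE typed conjunction on the B7/B8 `ℤ^d` carrier for the full field `U = U′U₀` ((1.16), bondwise product):
`𝔄_k` = `B8Ineq132.InAk L k η α₀ Ω` ((1.7)/(1.9) on the domains `Ω_j`, fine coordinates), `𝔅_k(𝔅_k, V)` = `InBk L k Λ V`
((1.13), literal reading, `Λ_j` in level coordinates), `Ax_k(𝔅_k, U₀)` = `B8Eq119TwistedAxial.InAx L k Λ U₀` ((1.19)).  For
the Sect. F family: `Ω = B8Eq131Cubes.cube L a M ρ k`, `Λ = B8Eq131Cubes.LamP L a M ρ k` — the binders of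
`B8Eq119TwistedAxial.Thm4At`. [cite: Balaban1985RegularSpaces, (1.28) p.81, (1.16) p.78] -/
def Class128 (L k : ℕ) (η α₀ : ℝ) (Ω Λ : ℕ → Set (Site d)) (V : ℕ → Site d → Fin d → 𝔸ˣ)
    (U₀ U' : Site d → Fin d → 𝔸ˣ) : Prop :=
  InAk L k η α₀ Ω (U' * U₀) ∧ InBk L k Λ V (U' * U₀) ∧ InAx L k Λ U₀ (U' * U₀)

omit [NormOneClass 𝔸] in
/-- Unfolding of (1.28). [cite: Balaban1985RegularSpaces, (1.28) p.81] -/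
theorem class128_iff (L k : ℕ) (η α₀ : ℝ) (Ω Λ : ℕ → Set (Site d)) (V : ℕ → Site d → Fin d → 𝔸ˣ)
    (U₀ U' : Site d → Fin d → 𝔸ˣ) :
    Class128 L k η α₀ Ω Λ V U₀ U' ↔
      InAk L k η α₀ Ω (U' * U₀) ∧ InBk L k Λ V (U' * U₀) ∧ InAx L k Λ U₀ (U' * U₀) :=
  Iff.rfl

omit [NormOneClass 𝔸] in
/-- (1.28) ⇒ `U′U₀ ∈ 𝔄_k({Ω_j}, α₀)` ((1.34)'s first clause). [cite: Balaban1985RegularSpaces, (1.28) p.81] -/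
theorem Class128.inAk {L k : ℕ} {η α₀ : ℝ} {Ω Λ : ℕ → Set (Site d)} {V : ℕ → Site d → Fin d → 𝔸ˣ}
    {U₀ U' : Site d → Fin d → 𝔸ˣ} (h : Class128 L k η α₀ Ω Λ V U₀ U') : InAk L k η α₀ Ω (U' * U₀) :=
  h.1

omit [NormOneClass 𝔸] in
/-- (1.28) ⇒ `U′U₀ ∈ 𝔅_k(𝔅_k, V)` ((1.13)). [cite: Balaban1985RegularSpaces, (1.28) p.81, (1.13) p.78] -/
theorem Class128.inBk {L k : ℕ} {η α₀ : ℝ} {Ω Λ : ℕ → Set (Site d)} {V : ℕ → Site d → Fin d → 𝔸ˣ}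
    {U₀ U' : Site d → Fin d → 𝔸ˣ} (h : Class128 L k η α₀ Ω Λ V U₀ U') : InBk L k Λ V (U' * U₀) :=
  h.2.1

omit [NormOneClass 𝔸] in
/-- (1.28) ⇒ `U′U₀ ∈ Ax_k(𝔅_k, U₀)` ((1.19)). [cite: Balaban1985RegularSpaces, (1.28) p.81, (1.19) p.79] -/
theorem Class128.inAx {L k : ℕ} {η α₀ : ℝ} {Ω Λ : ℕ → Set (Site d)} {V : ℕ → Site d → Fin d → 𝔸ˣ}
    {U₀ U' : Site d → Fin d → 𝔸ˣ} (h : Class128 L k η α₀ Ω Λ V U₀ U') : InAx L k Λ U₀ (U' * U₀) :=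
  h.2.2

omit [NormOneClass 𝔸] in
/-- (1.28) read bondwise on `𝔅_k(𝔅_k, V)`: the hypothesis shape `avgIter L (U′·U₀) j y κ = V j y κ` that the PROVED (1.30)/(1.31)
derivation `B8Eq131Derivation.eq131_interior/eq131_crossing` consumes at each constraint bond («The configurations U′ satisfy
the equations … on Λ_j», p. 81). [cite: Balaban1985RegularSpaces, (1.28) p.81, (1.30) p.81] -/
theorem Class128.avgIter_eq {L k : ℕ} {η α₀ : ℝ} {Ω Λ : ℕ → Set (Site d)} {V : ℕ → Site d → Fin d → 𝔸ˣ}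
    {U₀ U' : Site d → Fin d → 𝔸ˣ} (h : Class128 L k η α₀ Ω Λ V U₀ U') {j : ℕ} (hj : j ≤ k) {y : Site d} {κ : Fin d}
    (hb : y ∈ Λ j ∨ y + e κ ∈ Λ j) : avgIter L (U' * U₀) j y κ = V j y κ :=
  h.2.1 j hj y κ hb

end Class128

end Literature.MathematicalPhysics.QuantumFieldTheory.Balaban1983to89.B8Eq113ClassBk

end
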